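import Literature.Computability.Complexity.HardcoreInapproximabilitySSCAbstract
import HarnessLib

/-!
# Small subgraph conditioning — the lower tail with the control variate's own lower tail

A refinement of `ssc_lowerTail_le` (`HardcoreInapproximabilitySSCAbstract`) in the form actually
needed when `Σ_i λ_i δ_i` diverges (as for the bipartite configuration model near the uniqueness
threshold, where only `Σ_i λ_i δ_i² < ∞`): instead of bounding the polynomial control variate `W_B`
below by its minimum `1`, the event is split into `{W_B ≥ u}` — on which the `L²` regression bound
`ssc_lowerTail_on_le` applies with threshold `u · c'` — and `{W_B < u}`, whose size is controlled by
truncation (`card_exists_gt_le`: `#{∃ i, X_i > B} ≤ Σ_i E C(X_i, B+1)`), the identity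
`W_B = Π_i (1+δ_i)^{X_i}` on `{X ≤ B}` (`sscW_eq_prod_of_le`) and Chebyshev's inequality for the
linear statistic `Σ_i X_i log(1+δ_i)` under two-sided low-order factorial-moment bounds
(`card_linear_lowerTail_mul_sq_le`).  The resulting bound is `ssc_lowerTail_le'`; with
`u = exp(Σ λ_i log(1+δ_i) - M)` all three pieces are small once `M`, then `k`, then `B`, then the
moment accuracy `ε₁` and finally the threshold `t` are chosen in this order (Janson's argument).

## References
* [Sly2010] A. Sly, *Computational transition at the uniqueness threshold*, FOCS 2010,
  arXiv:1005.5584, Theorem 3.6 and the proof of Theorem 3.10.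
* [MosselWeitzWormald2008] E. Mossel, D. Weitz, N. Wormald, *On the hardness of sampling
  independent sets beyond the tree threshold*, PTRF 143 (2009), Theorem 7.1 (after Janson 1995).
-/

namespace Literature.Computability.Complexity

open Finset Nat

section AbstractSSC2

variable {Ω : Type*} {k : ℕ}

/-- **Lower tail via a control variate, restricted to `{W ≥ u}`**: if `c ≥ 0` and `a < c u` then
`#{Y ≤ a ∧ u ≤ W} · (cu - a)² ≤ Σ_ω (Y ω - c W ω)²`. [cite: Sly2010, Theorem 3.6 (after MWW09 Thm 7.1, Janson 1995)] -/
theorem card_lowerTail_on_mul_sq_le_sum_sq [Fintype Ω] (Y W : Ω → ℝ) {c a u : ℝ} (hc0 : 0 ≤ c)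
    (hct : a < c * u) [DecidablePred fun ω => Y ω ≤ a ∧ u ≤ W ω] :
    ((univ.filter fun ω => Y ω ≤ a ∧ u ≤ W ω).card : ℝ) * (c * u - a) ^ 2 ≤ ∑ ω, (Y ω - c * W ω) ^ 2 := by
  calc ((univ.filter fun ω => Y ω ≤ a ∧ u ≤ W ω).card : ℝ) * (c * u - a) ^ 2
      = ∑ _ω ∈ univ.filter (fun ω => Y ω ≤ a ∧ u ≤ W ω), (c * u - a) ^ 2 := by rw [Finset.sum_const, nsmul_eq_mul]
    _ ≤ ∑ ω ∈ univ.filter (fun ω => Y ω ≤ a ∧ u ≤ W ω), (Y ω - c * W ω) ^ 2 := by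
        refine Finset.sum_le_sum fun ω hω => ?_
        obtain ⟨hY, hu⟩ := (Finset.mem_filter.1 hω).2
        have h1 : c * u - a ≤ c * W ω - Y ω := by nlinarith [mul_le_mul_of_nonneg_left hu hc0]
        have h2 : 0 ≤ c * u - a := by linarith
        calc (c * u - a) ^ 2 ≤ (c * W ω - Y ω) ^ 2 := pow_le_pow_left₀ h2 h1 2
          _ = (Y ω - c * W ω) ^ 2 := by ring
    _ ≤ ∑ ω, (Y ω - c * W ω) ^ 2 :=
        Finset.sum_le_sum_of_subset_of_nonneg (Finset.filter_subset _ _) fun ω _ _ => sq_nonneg _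

/-- **The abstract small-subgraph-conditioning bound, restricted to `{W_B ≥ u}`** (same hypotheses as
`ssc_lowerTail_le`): `#{Y ≤ t · avg Y ∧ u ≤ W_B} ≤ θ_u |Ω|` with
`θ_u = [(1+ε₁)τ - (1-ε₁)² P_B²/((1+ε₁)A_B)] / [u (1-ε₁)P_B/((1+ε₁)A_B) - t]²`.
[cite: Sly2010, Theorem 3.6 (after Janson / MWW09 Thm 4.2), L² control-variate form] -/
theorem ssc_lowerTail_on_le [Fintype Ω] (X : Fin k → Ω → ℕ) (Y : Ω → ℝ) (hYpos : 0 < ∑ ω, Y ω)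
    {δ lam : Fin k → ℝ} (hδ : ∀ i, 0 ≤ δ i) (hlam : ∀ i, 0 ≤ lam i) (B : ℕ) {ε₁ τ t u : ℝ}
    (hε₁ : 0 ≤ ε₁) (hε₁1 : ε₁ < 1)
    (hU : ∀ c : Fin k → ℕ, (∀ i, c i ≤ 2 * B) →
      ∑ ω, sscBinom X c ω ≤ (1 + ε₁) * Fintype.card Ω * ∏ i, lam i ^ c i / ((c i)! : ℝ))
    (hP : ∀ c : Fin k → ℕ, (∀ i, c i ≤ B) →
      (1 - ε₁) * (∑ ω, Y ω) * ∏ i, (lam i * (1 + δ i)) ^ c i / ((c i)! : ℝ) ≤ ∑ ω, Y ω * sscBinom X c ω)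
    (hS : (Fintype.card Ω : ℝ) * ∑ ω, Y ω ^ 2 ≤ (1 + ε₁) * τ * (∑ ω, Y ω) ^ 2)
    (hu : 0 < u) (hden : t < u * ((1 - ε₁) * sscP lam δ B / ((1 + ε₁) * sscA lam δ B))) :
    haveI := Classical.decPred fun ω => Y ω ≤ t * ((∑ ω, Y ω) / Fintype.card Ω) ∧ u ≤ sscW X δ B ω
    ((univ.filter fun ω => Y ω ≤ t * ((∑ ω, Y ω) / Fintype.card Ω) ∧ u ≤ sscW X δ B ω).card : ℝ) ≤
      ((1 + ε₁) * τ - (1 - ε₁) ^ 2 * sscP lam δ B ^ 2 / ((1 + ε₁) * sscA lam δ B)) /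
        (u * ((1 - ε₁) * sscP lam δ B / ((1 + ε₁) * sscA lam δ B)) - t) ^ 2 * Fintype.card Ω := by
  have hΩ : 0 < (Fintype.card Ω : ℝ) := by
    have : Nonempty Ω := by
      by_contra h
      rw [not_nonempty_iff] at h
      simp at hYpos
    exact_mod_cast Fintype.card_pos
  set W := sscW X δ B with hWdef
  set SY := ∑ ω, Y ω with hSY
  set SW2 := ∑ ω, W ω ^ 2 with hSW2
  set SYW := ∑ ω, Y ω * W ω with hSYW
  set A := sscA lam δ B with hA
  set P := sscP lam δ B with hP_def
  have hW1 : ∀ ω, 1 ≤ W ω := one_le_sscW hδ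
  have hP0 : 0 < P := by
    rw [hP_def]; unfold sscP
    rw [← Finset.add_sum_erase _ _ (zero_mem_sscBox k B)]
    simp only [pow_zero, Nat.factorial_zero, Nat.cast_one, div_one, Finset.prod_const_one]
    have : 0 ≤ ∑ c ∈ (sscBox k B).erase (fun _ => 0), ∏ i, (lam i * (1 + δ i) * δ i) ^ c i / ((c i)! : ℝ) :=
      Finset.sum_nonneg fun c _ => Finset.prod_nonneg fun i _ => by
        have := hδ i; have := hlam i; positivity
    linarith
  -- `Σ W² ≤ (1+ε₁)|Ω| A`
  have hW2 : SW2 ≤ (1 + ε₁) * Fintype.card Ω * A := by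
    rw [hSW2]
    simp_rw [hWdef, sscW_sq]
    rw [Finset.sum_comm]
    rw [hA]; unfold sscA
    rw [Finset.mul_sum]
    refine Finset.sum_le_sum fun c hc => ?_
    rw [Finset.sum_comm, Finset.mul_sum]
    refine Finset.sum_le_sum fun c' hc' => ?_
    rw [← Finset.mul_sum]
    have hcoef : 0 ≤ (∏ i, δ i ^ c i) * (∏ i, δ i ^ c' i) :=
      mul_nonneg (Finset.prod_nonneg fun i _ => pow_nonneg (hδ i) _) (Finset.prod_nonneg fun i _ => pow_nonneg (hδ i) _)
    rw [show (1 + ε₁) * (Fintype.card Ω : ℝ) * ((∏ i, δ i ^ c i) * (∏ i, δ i ^ c' i) *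
        ∏ i, ∑ r ∈ range (c' i + 1), ((c i).choose r : ℝ) * (((c i) + (c' i - r)).choose (c i) : ℝ) *
          (lam i ^ (c i + (c' i - r)) / ((c i + (c' i - r))! : ℝ))) =
      (∏ i, δ i ^ c i) * (∏ i, δ i ^ c' i) * ((1 + ε₁) * (Fintype.card Ω : ℝ) *
        ∏ i, ∑ r ∈ range (c' i + 1), ((c i).choose r : ℝ) * (((c i) + (c' i - r)).choose (c i) : ℝ) *
          (lam i ^ (c i + (c' i - r)) / ((c i + (c' i - r))! : ℝ))) by ring]
    apply mul_le_mul_of_nonneg_left _ hcoef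
    simp_rw [Finset.prod_univ_sum]
    rw [show ∑ ω, ∑ r ∈ Fintype.piFinset fun i => range (c' i + 1),
        ∏ i, ((c i).choose (r i) : ℝ) * (((c i) + (c' i - r i)).choose (c i) : ℝ) * ((X i ω).choose (c i + (c' i - r i)) : ℝ) =
      ∑ r ∈ Fintype.piFinset fun i => range (c' i + 1),
        (∏ i, ((c i).choose (r i) : ℝ) * (((c i) + (c' i - r i)).choose (c i) : ℝ)) *
          ∑ ω, sscBinom X (fun i => c i + (c' i - r i)) ω by
      rw [Finset.sum_comm]
      refine Finset.sum_congr rfl fun r _ => ?_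
      rw [Finset.mul_sum]
      refine Finset.sum_congr rfl fun ω _ => ?_
      unfold sscBinom
      rw [← Finset.prod_mul_distrib]]
    rw [Finset.mul_sum]
    refine Finset.sum_le_sum fun r hr => ?_
    have hcr : 0 ≤ ∏ i, ((c i).choose (r i) : ℝ) * (((c i) + (c' i - r i)).choose (c i) : ℝ) :=
      Finset.prod_nonneg fun i _ => by positivity
    have hcb : ∀ i, c i + (c' i - r i) ≤ 2 * B := by
      intro i
      have h1 := (mem_sscBox.mp hc) i
      have h2 := (mem_sscBox.mp hc') i
      omega
    have := mul_le_mul_of_nonneg_left (hU (fun i => c i + (c' i - r i)) hcb) hcr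
    refine le_trans this (le_of_eq ?_)
    rw [show (∏ i, ((c i).choose (r i) : ℝ) * (((c i) + (c' i - r i)).choose (c i) : ℝ)) *
        ((1 + ε₁) * (Fintype.card Ω : ℝ) * ∏ i, lam i ^ (c i + (c' i - r i)) / ((c i + (c' i - r i))! : ℝ)) =
      (1 + ε₁) * (Fintype.card Ω : ℝ) * ((∏ i, ((c i).choose (r i) : ℝ) * (((c i) + (c' i - r i)).choose (c i) : ℝ)) *
        ∏ i, lam i ^ (c i + (c' i - r i)) / ((c i + (c' i - r i))! : ℝ)) by ring]
    congr 1
    rw [← Finset.prod_mul_distrib]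
  -- `Σ Y W ≥ (1-ε₁) SY P`
  have hYW : (1 - ε₁) * SY * P ≤ SYW := by
    rw [hSYW]
    simp_rw [hWdef, sscW, Finset.mul_sum]
    rw [Finset.sum_comm]
    rw [hP_def]; unfold sscP
    rw [Finset.mul_sum]
    refine Finset.sum_le_sum fun c hc => ?_
    have hc' := mem_sscBox.mp hc
    have h := hP c hc'
    have hcoef : 0 ≤ ∏ i, δ i ^ c i := Finset.prod_nonneg fun i _ => pow_nonneg (hδ i) _
    calc (1 - ε₁) * SY * ∏ i, (lam i * (1 + δ i) * δ i) ^ c i / ((c i)! : ℝ)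
        = (∏ i, δ i ^ c i) * ((1 - ε₁) * SY * ∏ i, (lam i * (1 + δ i)) ^ c i / ((c i)! : ℝ)) := by
          rw [show ∏ i, (lam i * (1 + δ i) * δ i) ^ c i / ((c i)! : ℝ) =
              (∏ i, δ i ^ c i) * ∏ i, (lam i * (1 + δ i)) ^ c i / ((c i)! : ℝ) by
            rw [← Finset.prod_mul_distrib]
            refine Finset.prod_congr rfl fun i _ => ?_
            rw [mul_pow]; ring]
          ring
      _ ≤ (∏ i, δ i ^ c i) * ∑ ω, Y ω * sscBinom X c ω := mul_le_mul_of_nonneg_left h hcoef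
      _ = ∑ ω, Y ω * ((∏ i, δ i ^ c i) * sscBinom X c ω) := by rw [Finset.mul_sum]; refine Finset.sum_congr rfl fun ω _ => ?_; ring
  have hSW2pos : 0 < SW2 := by
    rw [hSW2]
    have : ∀ ω, (1:ℝ) ≤ W ω ^ 2 := fun ω => by nlinarith [hW1 ω]
    calc (0:ℝ) < ∑ _ω : Ω, (1:ℝ) := by rw [Finset.sum_const, nsmul_eq_mul, mul_one]; exact hΩ
      _ ≤ _ := Finset.sum_le_sum fun ω _ => this ω
  have hA0 : 0 < A := by
    have : SW2 ≤ (1 + ε₁) * Fintype.card Ω * A := hW2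
    by_contra hle
    push Not at hle
    have : (1 + ε₁) * (Fintype.card Ω : ℝ) * A ≤ 0 :=
      mul_nonpos_of_nonneg_of_nonpos (by positivity) hle
    linarith
  set c₀ := SYW / SW2 with hc₀
  have hc₀ge : (1 - ε₁) * SY * P / ((1 + ε₁) * Fintype.card Ω * A) ≤ c₀ := by
    rw [hc₀]
    have h1 : (1 - ε₁) * SY * P / ((1 + ε₁) * Fintype.card Ω * A) ≤ (1 - ε₁) * SY * P / SW2 :=
      div_le_div_of_nonneg_left (by have := hYpos; positivity) hSW2pos hW2
    exact le_trans h1 (div_le_div_of_nonneg_right hYW hSW2pos.le)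
  set avg := SY / Fintype.card Ω with havg
  have havg0 : 0 < avg := by positivity
  set c' := (1 - ε₁) * P / ((1 + ε₁) * A) with hc'
  letI iY : DecidablePred fun ω => Y ω ≤ t * avg ∧ u ≤ W ω := Classical.decPred _
  -- the threshold is below `c₀ u`
  have hgap : avg * (u * c' - t) ≤ c₀ * u - t * avg := by
    have e : avg * c' = (1 - ε₁) * SY * P / ((1 + ε₁) * Fintype.card Ω * A) := by
      rw [havg, hc']; field_simp
    have : avg * c' * u ≤ c₀ * u := mul_le_mul_of_nonneg_right (by rw [e]; exact hc₀ge) hu.le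
    nlinarith
  have hct : t * avg < c₀ * u := by
    have : 0 < avg * (u * c' - t) := mul_pos havg0 (by linarith)
    linarith
  have hc₀0 : 0 ≤ c₀ := by rw [hc₀]; exact div_nonneg (le_trans (by have := hYpos; positivity) hYW) hSW2pos.le
  -- the L² bound
  have hL := card_lowerTail_on_mul_sq_le_sum_sq Y W hc₀0 hct
  rw [hc₀, sum_sq_sub_optimal Y W hSW2pos, ← hc₀] at hL
  have hnum : ∑ ω, Y ω ^ 2 - SYW ^ 2 / SW2 ≤
      avg ^ 2 * Fintype.card Ω * ((1 + ε₁) * τ - (1 - ε₁) ^ 2 * P ^ 2 / ((1 + ε₁) * A)) := by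
    have h1 : ∑ ω, Y ω ^ 2 ≤ (1 + ε₁) * τ * SY ^ 2 / Fintype.card Ω := by
      rw [le_div_iff₀ hΩ]; linarith [hS]
    have h2 : ((1 - ε₁) * SY * P) ^ 2 / ((1 + ε₁) * Fintype.card Ω * A) ≤ SYW ^ 2 / SW2 := by
      have hnn : 0 ≤ (1 - ε₁) * SY * P := by have := hYpos; positivity
      calc ((1 - ε₁) * SY * P) ^ 2 / ((1 + ε₁) * Fintype.card Ω * A)
          ≤ SYW ^ 2 / ((1 + ε₁) * Fintype.card Ω * A) :=
            div_le_div_of_nonneg_right (pow_le_pow_left₀ hnn hYW 2) (by positivity)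
        _ ≤ SYW ^ 2 / SW2 := div_le_div_of_nonneg_left (by positivity) hSW2pos hW2
    have e : avg ^ 2 * Fintype.card Ω * ((1 + ε₁) * τ - (1 - ε₁) ^ 2 * P ^ 2 / ((1 + ε₁) * A)) =
        (1 + ε₁) * τ * SY ^ 2 / Fintype.card Ω - ((1 - ε₁) * SY * P) ^ 2 / ((1 + ε₁) * Fintype.card Ω * A) := by
      rw [havg]; field_simp
    linarith [h1, h2, e]
  have hden0 : 0 < u * c' - t := by linarith
  have hsq : avg ^ 2 * (u * c' - t) ^ 2 ≤ (c₀ * u - t * avg) ^ 2 := by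
    have := pow_le_pow_left₀ (by positivity) hgap 2
    rw [mul_pow] at this; exact this
  have hcard0 : 0 ≤ ((univ.filter fun ω => Y ω ≤ t * avg ∧ u ≤ W ω).card : ℝ) := by positivity
  have key : ((univ.filter fun ω => Y ω ≤ t * avg ∧ u ≤ W ω).card : ℝ) * (avg ^ 2 * (u * c' - t) ^ 2) ≤
      avg ^ 2 * Fintype.card Ω * ((1 + ε₁) * τ - (1 - ε₁) ^ 2 * P ^ 2 / ((1 + ε₁) * A)) :=
    le_trans (le_trans (mul_le_mul_of_nonneg_left hsq hcard0) hL) hnum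
  have havg2 : 0 < avg ^ 2 := by positivity
  rw [div_mul_eq_mul_div, le_div_iff₀ (pow_pos hden0 2)]
  have h2 : ((univ.filter fun ω => Y ω ≤ t * avg ∧ u ≤ W ω).card : ℝ) * (u * c' - t) ^ 2 * avg ^ 2 ≤
      ((1 + ε₁) * τ - (1 - ε₁) ^ 2 * P ^ 2 / ((1 + ε₁) * A)) * Fintype.card Ω * avg ^ 2 := by
    calc ((univ.filter fun ω => Y ω ≤ t * avg ∧ u ≤ W ω).card : ℝ) * (u * c' - t) ^ 2 * avg ^ 2
        = ((univ.filter fun ω => Y ω ≤ t * avg ∧ u ≤ W ω).card : ℝ) * (avg ^ 2 * (u * c' - t) ^ 2) := by ring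
      _ ≤ avg ^ 2 * Fintype.card Ω * ((1 + ε₁) * τ - (1 - ε₁) ^ 2 * P ^ 2 / ((1 + ε₁) * A)) := key
      _ = _ := by ring
  exact le_of_mul_le_mul_right h2 havg2

/-- **Chebyshev for a nonnegative linear statistic of the counts** under two-sided first-moment and
upper second-moment bounds: with `ℓ_i, λ_i ≥ 0`,
`#{Σ ℓ_i X_i ≤ Σ ℓ_i λ_i - M} · M² ≤ |Ω| · [(1+ε) Σ λ_i ℓ_i² + 3ε (Σ λ_i ℓ_i)²]`. [folklore] -/
theorem card_linear_lowerTail_mul_sq_le [Fintype Ω] (X : Fin k → Ω → ℕ) (lam ℓ : Fin k → ℝ)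
    (hlam : ∀ i, 0 ≤ lam i) (hℓ : ∀ i, 0 ≤ ℓ i) {ε M : ℝ} (hM : 0 ≤ M)
    (h1u : ∀ i, ∑ ω, (X i ω : ℝ) ≤ (1 + ε) * Fintype.card Ω * lam i)
    (h1l : ∀ i, (1 - ε) * Fintype.card Ω * lam i ≤ ∑ ω, (X i ω : ℝ))
    (h2 : ∀ i, ∑ ω, ((X i ω).choose 2 : ℝ) ≤ (1 + ε) * Fintype.card Ω * (lam i ^ 2 / 2))
    (h11 : ∀ i j, i ≠ j → ∑ ω, (X i ω : ℝ) * (X j ω : ℝ) ≤ (1 + ε) * Fintype.card Ω * (lam i * lam j)) :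
    haveI := Classical.decPred fun ω => ∑ i, ℓ i * X i ω ≤ ∑ i, ℓ i * lam i - M
    ((univ.filter fun ω => ∑ i, ℓ i * X i ω ≤ ∑ i, ℓ i * lam i - M).card : ℝ) * M ^ 2 ≤
      Fintype.card Ω * ((1 + ε) * ∑ i, lam i * ℓ i ^ 2 + 3 * ε * (∑ i, lam i * ℓ i) ^ 2) := by
  letI iD : DecidablePred fun ω => ∑ i, ℓ i * X i ω ≤ ∑ i, ℓ i * lam i - M := Classical.decPred _
  set D : Ω → ℝ := fun ω => ∑ i, ℓ i * ((X i ω : ℝ) - lam i) with hD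
  -- Chebyshev step
  have hstep : ((univ.filter fun ω => ∑ i, ℓ i * X i ω ≤ ∑ i, ℓ i * lam i - M).card : ℝ) * M ^ 2 ≤ ∑ ω, D ω ^ 2 := by
    calc ((univ.filter fun ω => ∑ i, ℓ i * X i ω ≤ ∑ i, ℓ i * lam i - M).card : ℝ) * M ^ 2
        = ∑ _ω ∈ univ.filter (fun ω => ∑ i, ℓ i * X i ω ≤ ∑ i, ℓ i * lam i - M), M ^ 2 := by
          rw [Finset.sum_const, nsmul_eq_mul]
      _ ≤ ∑ ω ∈ univ.filter (fun ω => ∑ i, ℓ i * X i ω ≤ ∑ i, ℓ i * lam i - M), D ω ^ 2 := by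
          refine Finset.sum_le_sum fun ω hω => ?_
          have h := (Finset.mem_filter.1 hω).2
          have hDω : D ω = ∑ i, ℓ i * X i ω - ∑ i, ℓ i * lam i := by
            simp only [hD, mul_sub, Finset.sum_sub_distrib]
          have hle : D ω ≤ -M := by rw [hDω]; linarith
          nlinarith
      _ ≤ ∑ ω, D ω ^ 2 := Finset.sum_le_sum_of_subset_of_nonneg (Finset.filter_subset _ _) fun ω _ _ => sq_nonneg _
  refine le_trans hstep ?_
  -- expand the square
  have hexp : ∑ ω, D ω ^ 2 = ∑ i, ∑ j, ℓ i * ℓ j * ∑ ω, ((X i ω : ℝ) - lam i) * ((X j ω : ℝ) - lam j) := by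
    have : ∀ ω, D ω ^ 2 = ∑ i, ∑ j, ℓ i * ℓ j * (((X i ω : ℝ) - lam i) * ((X j ω : ℝ) - lam j)) := by
      intro ω
      rw [hD, sq, Finset.sum_mul_sum]
      refine Finset.sum_congr rfl fun i _ => Finset.sum_congr rfl fun j _ => ?_
      ring
    simp_rw [this]
    rw [Finset.sum_comm]
    refine Finset.sum_congr rfl fun i _ => ?_
    rw [Finset.sum_comm]
    refine Finset.sum_congr rfl fun j _ => ?_
    rw [Finset.mul_sum]
  rw [hexp]
  -- the pair sums
  have hT : ∀ i j, ∑ ω, ((X i ω : ℝ) - lam i) * ((X j ω : ℝ) - lam j) ≤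
      3 * ε * Fintype.card Ω * (lam i * lam j) + (if i = j then (1 + ε) * Fintype.card Ω * lam i else 0) := by
    intro i j
    have hexp2 : ∑ ω, ((X i ω : ℝ) - lam i) * ((X j ω : ℝ) - lam j) =
        ∑ ω, (X i ω : ℝ) * (X j ω : ℝ) - lam i * ∑ ω, (X j ω : ℝ) - lam j * ∑ ω, (X i ω : ℝ) +
          Fintype.card Ω * (lam i * lam j) := by
      have : ∀ ω, ((X i ω : ℝ) - lam i) * ((X j ω : ℝ) - lam j) =
          (X i ω : ℝ) * (X j ω : ℝ) - lam i * (X j ω : ℝ) - lam j * (X i ω : ℝ) + lam i * lam j := fun ω => by ring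
      simp_rw [this]
      rw [Finset.sum_add_distrib, Finset.sum_sub_distrib, Finset.sum_sub_distrib, ← Finset.mul_sum, ← Finset.mul_sum,
        Finset.sum_const, Finset.card_univ, nsmul_eq_mul]
    rw [hexp2]
    have hli := hlam i; have hlj := hlam j
    by_cases hij : i = j
    · subst hij
      rw [if_pos rfl]
      have hsq : ∑ ω, (X i ω : ℝ) * (X i ω : ℝ) = 2 * ∑ ω, ((X i ω).choose 2 : ℝ) + ∑ ω, (X i ω : ℝ) := by
        rw [Finset.mul_sum, ← Finset.sum_add_distrib]
        refine Finset.sum_congr rfl fun ω _ => ?_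
        rw [Nat.cast_choose_two]; ring
      rw [hsq]
      have a1 := h2 i; have a2 := h1u i; have a3 := h1l i
      nlinarith
    · rw [if_neg hij, add_zero]
      have a1 := h11 i j hij; have a2 := h1l i; have a3 := h1l j
      nlinarith
  calc ∑ i, ∑ j, ℓ i * ℓ j * ∑ ω, ((X i ω : ℝ) - lam i) * ((X j ω : ℝ) - lam j)
      ≤ ∑ i, ∑ j, ℓ i * ℓ j * (3 * ε * Fintype.card Ω * (lam i * lam j) + (if i = j then (1 + ε) * Fintype.card Ω * lam i else 0)) :=
        Finset.sum_le_sum fun i _ => Finset.sum_le_sum fun j _ =>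
          mul_le_mul_of_nonneg_left (hT i j) (mul_nonneg (hℓ i) (hℓ j))
    _ = Fintype.card Ω * ((1 + ε) * ∑ i, lam i * ℓ i ^ 2 + 3 * ε * (∑ i, lam i * ℓ i) ^ 2) := by
        simp_rw [mul_add, Finset.sum_add_distrib, mul_ite, mul_zero, Finset.sum_ite_eq, Finset.mem_univ, if_true]
        have eq1 : ∑ i, ∑ j, ℓ i * ℓ j * (3 * ε * Fintype.card Ω * (lam i * lam j)) =
            Fintype.card Ω * (3 * ε * (∑ i, lam i * ℓ i) ^ 2) := by
          rw [sq, Finset.sum_mul_sum, Finset.mul_sum, Finset.mul_sum]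
          refine Finset.sum_congr rfl fun i _ => ?_
          rw [Finset.mul_sum, Finset.mul_sum]
          refine Finset.sum_congr rfl fun j _ => ?_
          ring
        have eq2 : ∑ i, ℓ i * ℓ i * ((1 + ε) * Fintype.card Ω * lam i) = Fintype.card Ω * ((1 + ε) * ∑ i, lam i * ℓ i ^ 2) := by
          rw [Finset.mul_sum, Finset.mul_sum]
          refine Finset.sum_congr rfl fun i _ => ?_
          ring
        rw [eq1, eq2]
        ring

/-- **Truncation**: `#{∃ i, X_i > B} ≤ Σ_i Σ_ω C(X_i(ω), B+1)`. [folklore] -/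
theorem card_exists_gt_le [Fintype Ω] (X : Fin k → Ω → ℕ) (B : ℕ) :
    haveI := Classical.decPred fun ω => ∃ i, B < X i ω
    ((univ.filter fun ω => ∃ i, B < X i ω).card : ℝ) ≤ ∑ i, ∑ ω, ((X i ω).choose (B + 1) : ℝ) := by
  letI iE : DecidablePred fun ω => ∃ i, B < X i ω := Classical.decPred _
  rw [Finset.card_filter, Finset.sum_comm]
  push_cast
  refine Finset.sum_le_sum fun ω _ => ?_
  split_ifs with h
  · obtain ⟨i, hi⟩ := h
    have h1 : (1 : ℝ) ≤ ((X i ω).choose (B + 1) : ℝ) := by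
      exact_mod_cast Nat.choose_pos hi
    exact le_trans h1 (Finset.single_le_sum (f := fun j => (((X j ω).choose (B + 1) : ℕ) : ℝ)) (fun j _ => Nat.cast_nonneg _) (Finset.mem_univ i))
  · exact Finset.sum_nonneg fun j _ => Nat.cast_nonneg _

/-- **On `{X ≤ B}` the polynomial control variate is the full tilt** `Π_i (1+δ_i)^{X_i}`. [folklore] -/
theorem sscW_eq_prod_of_le {X : Fin k → Ω → ℕ} (δ : Fin k → ℝ) {B : ℕ} {ω : Ω} (hX : ∀ i, X i ω ≤ B) :
    sscW X δ B ω = ∏ i, (1 + δ i) ^ (X i ω) := by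
  unfold sscW sscBinom sscBox
  have h1 : ∀ c : Fin k → ℕ, (∏ i, δ i ^ c i) * ∏ i, ((X i ω).choose (c i) : ℝ) = ∏ i, (δ i ^ c i * ((X i ω).choose (c i) : ℝ)) := by
    intro c; rw [← Finset.prod_mul_distrib]
  simp_rw [h1]
  rw [← Finset.prod_univ_sum (t := fun _ => range (B + 1)) (f := fun i c => δ i ^ c * ((X i ω).choose c : ℝ))]
  refine Finset.prod_congr rfl fun i _ => ?_
  have hsub : range (X i ω + 1) ⊆ range (B + 1) := Finset.range_subset_range.2 (Nat.succ_le_succ (hX i))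
  have hf : ∀ m ∈ range (B + 1), m ∉ range (X i ω + 1) → ((X i ω).choose m : ℝ) * δ i ^ m = 0 := by
    intro m hm hm'
    rw [Finset.mem_range] at hm hm'
    rw [Nat.choose_eq_zero_of_lt (by omega)]; simp
  rw [one_add_pow_eq_sum_choose, Finset.sum_subset hsub hf]
  refine Finset.sum_congr rfl fun c _ => ?_; ring

/-- **The abstract small-subgraph-conditioning lower tail, with the control variate's own lower tail**
(Janson's form): under upper binomial-moment bounds of orders `≤ 2B`, lower ones of orders `≤ 2B`
(used at orders `1`), the planted lower bounds of orders `≤ B`, and the second-moment bound,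
`#{Y ≤ t · avg Y} ≤ |Ω| · (θ₁ + θ₂ + θ₃)` with
`θ₁ = [(1+ε₁)τ - (1-ε₁)² P²/((1+ε₁)A)]/[u c' - t]²` (`u = exp(Σ λ_i log(1+δ_i) - M)`, `c' = (1-ε₁)P/((1+ε₁)A)`),
`θ₂ = (1+ε₁) Σ_i λ_i^{B+1}/(B+1)!` (truncation) and `θ₃ = [(1+ε₁)Σλ_i ℓ_i² + 3ε₁(Σλ_iℓ_i)²]/M²`
(Chebyshev for `log W`, `ℓ_i = log(1+δ_i)`). [cite: Sly2010, Theorem 3.6; MosselWeitzWormald2008, Theorem 7.1 (after Janson 1995)] -/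
theorem ssc_lowerTail_le' [Fintype Ω] (X : Fin k → Ω → ℕ) (Y : Ω → ℝ) (hYpos : 0 < ∑ ω, Y ω)
    {δ lam : Fin k → ℝ} (hδ : ∀ i, 0 ≤ δ i) (hlam : ∀ i, 0 ≤ lam i) {B : ℕ} (hB : 1 ≤ B) {ε₁ τ t M : ℝ}
    (hε₁ : 0 ≤ ε₁) (hε₁1 : ε₁ < 1) (hM : 0 < M)
    (hU : ∀ c : Fin k → ℕ, (∀ i, c i ≤ 2 * B) →
      ∑ ω, sscBinom X c ω ≤ (1 + ε₁) * Fintype.card Ω * ∏ i, lam i ^ c i / ((c i)! : ℝ))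
    (hL : ∀ c : Fin k → ℕ, (∀ i, c i ≤ 2 * B) →
      (1 - ε₁) * Fintype.card Ω * ∏ i, lam i ^ c i / ((c i)! : ℝ) ≤ ∑ ω, sscBinom X c ω)
    (hP : ∀ c : Fin k → ℕ, (∀ i, c i ≤ B) →
      (1 - ε₁) * (∑ ω, Y ω) * ∏ i, (lam i * (1 + δ i)) ^ c i / ((c i)! : ℝ) ≤ ∑ ω, Y ω * sscBinom X c ω)
    (hS : (Fintype.card Ω : ℝ) * ∑ ω, Y ω ^ 2 ≤ (1 + ε₁) * τ * (∑ ω, Y ω) ^ 2)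
    (hden : t < Real.exp (∑ i, lam i * Real.log (1 + δ i) - M) *
      ((1 - ε₁) * sscP lam δ B / ((1 + ε₁) * sscA lam δ B))) :
    haveI := Classical.decPred fun ω => Y ω ≤ t * ((∑ ω, Y ω) / Fintype.card Ω)
    ((univ.filter fun ω => Y ω ≤ t * ((∑ ω, Y ω) / Fintype.card Ω)).card : ℝ) ≤
      Fintype.card Ω *
        (((1 + ε₁) * τ - (1 - ε₁) ^ 2 * sscP lam δ B ^ 2 / ((1 + ε₁) * sscA lam δ B)) /
            (Real.exp (∑ i, lam i * Real.log (1 + δ i) - M) * ((1 - ε₁) * sscP lam δ B / ((1 + ε₁) * sscA lam δ B)) - t) ^ 2 +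
          (1 + ε₁) * ∑ i, lam i ^ (B + 1) / ((B + 1)! : ℝ) +
          ((1 + ε₁) * ∑ i, lam i * Real.log (1 + δ i) ^ 2 + 3 * ε₁ * (∑ i, lam i * Real.log (1 + δ i)) ^ 2) / M ^ 2) := by
  letI iΩ : DecidableEq Ω := Classical.decEq Ω
  set u : ℝ := Real.exp (∑ i, lam i * Real.log (1 + δ i) - M) with hu
  have hu0 : 0 < u := Real.exp_pos _
  set avg := (∑ ω, Y ω) / Fintype.card Ω with havg
  set W := sscW X δ B with hW
  set ℓ : Fin k → ℝ := fun i => Real.log (1 + δ i) with hℓ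
  have hℓ0 : ∀ i, 0 ≤ ℓ i := fun i => Real.log_nonneg (by linarith [hδ i])
  letI iY0 : DecidablePred fun ω => Y ω ≤ t * avg := Classical.decPred _
  letI i1 : DecidablePred fun ω => Y ω ≤ t * avg ∧ u ≤ W ω := Classical.decPred _
  letI i2 : DecidablePred fun ω => ∃ i, B < X i ω := Classical.decPred _
  letI i3 : DecidablePred fun ω => ∑ i, ℓ i * X i ω ≤ ∑ i, ℓ i * lam i - M := Classical.decPred _
  -- split the event
  have hsplit : (univ.filter fun ω => Y ω ≤ t * avg) ⊆
      (univ.filter fun ω => Y ω ≤ t * avg ∧ u ≤ W ω) ∪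
        ((univ.filter fun ω => ∃ i, B < X i ω) ∪ (univ.filter fun ω => ∑ i, ℓ i * X i ω ≤ ∑ i, ℓ i * lam i - M)) := by
    intro ω hω
    rw [Finset.mem_filter] at hω
    rw [Finset.mem_union, Finset.mem_union, Finset.mem_filter, Finset.mem_filter, Finset.mem_filter]
    by_cases huW : u ≤ W ω
    · exact Or.inl ⟨Finset.mem_univ _, hω.2, huW⟩
    · right
      by_cases hXB : ∃ i, B < X i ω
      · exact Or.inl ⟨Finset.mem_univ _, hXB⟩
      · right
        refine ⟨Finset.mem_univ _, ?_⟩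
        push Not at huW hXB
        have hWeq : W ω = ∏ i, (1 + δ i) ^ (X i ω) := sscW_eq_prod_of_le δ hXB
        have hWexp : W ω = Real.exp (∑ i, ℓ i * X i ω) := by
          rw [hWeq, Real.exp_sum]
          refine Finset.prod_congr rfl fun i _ => ?_
          rw [hℓ]; dsimp only
          rw [Real.exp_mul, Real.exp_log (by linarith [hδ i]), Real.rpow_natCast]
        rw [hWexp, hu] at huW
        have := Real.exp_lt_exp.1 huW
        have hcomm : ∑ i, lam i * Real.log (1 + δ i) = ∑ i, ℓ i * lam i := Finset.sum_congr rfl fun i _ => by rw [hℓ]; ring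
        linarith
  have hcard : (univ.filter fun ω => Y ω ≤ t * avg).card ≤
      (univ.filter fun ω => Y ω ≤ t * avg ∧ u ≤ W ω).card +
        ((univ.filter fun ω => ∃ i, B < X i ω).card + (univ.filter fun ω => ∑ i, ℓ i * X i ω ≤ ∑ i, ℓ i * lam i - M).card) :=
    calc _ ≤ _ := Finset.card_le_card hsplit
      _ ≤ _ := Finset.card_union_le _ _
      _ ≤ _ := Nat.add_le_add_left (Finset.card_union_le _ _) _
  have hcardR : ((univ.filter fun ω => Y ω ≤ t * avg).card : ℝ) ≤
      ((univ.filter fun ω => Y ω ≤ t * avg ∧ u ≤ W ω).card : ℝ) +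
        (((univ.filter fun ω => ∃ i, B < X i ω).card : ℝ) + ((univ.filter fun ω => ∑ i, ℓ i * X i ω ≤ ∑ i, ℓ i * lam i - M).card : ℝ)) := by
    exact_mod_cast hcard
  -- the three pieces
  have h1 := ssc_lowerTail_on_le X Y hYpos hδ hlam B hε₁ hε₁1 hU hP hS hu0 hden
  have hΩ0 : (0 : ℝ) ≤ Fintype.card Ω := Nat.cast_nonneg _
  have h2 : ((univ.filter fun ω => ∃ i, B < X i ω).card : ℝ) ≤ Fintype.card Ω * ((1 + ε₁) * ∑ i, lam i ^ (B + 1) / ((B + 1)! : ℝ)) := by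
    refine le_trans (card_exists_gt_le X B) ?_
    rw [Finset.mul_sum, Finset.mul_sum]
    refine Finset.sum_le_sum fun i _ => ?_
    -- `Σ_ω C(X_i, B+1) = Σ_ω sscBinom X (single i (B+1))`
    have hc : ∀ j, (Pi.single i (B + 1) : Fin k → ℕ) j ≤ 2 * B := by
      intro j
      by_cases hj : j = i
      · subst hj; simp; omega
      · rw [Pi.single_eq_of_ne hj]; omega
    have h := hU (Pi.single i (B + 1)) hc
    have hbin : ∀ ω, sscBinom X (Pi.single i (B + 1)) ω = ((X i ω).choose (B + 1) : ℝ) := by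
      intro ω
      unfold sscBinom
      rw [Finset.prod_eq_single i (fun j _ hj => by rw [Pi.single_eq_of_ne hj, Nat.choose_zero_right, Nat.cast_one])
        (fun h => absurd (Finset.mem_univ i) h), Pi.single_eq_same]
    have hprod : ∏ j, lam j ^ (Pi.single i (B + 1) : Fin k → ℕ) j / (((Pi.single i (B + 1) : Fin k → ℕ) j)! : ℝ) =
        lam i ^ (B + 1) / ((B + 1)! : ℝ) := by
      rw [Finset.prod_eq_single i (fun j _ hj => by rw [Pi.single_eq_of_ne hj]; simp)
        (fun h => absurd (Finset.mem_univ i) h), Pi.single_eq_same]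
    simp_rw [hbin] at h
    rw [hprod] at h
    linarith
  have h3 := card_linear_lowerTail_mul_sq_le (ε := ε₁) X lam ℓ hlam hℓ0 hM.le ?_ ?_ ?_ ?_
  rotate_left
  · -- first moments, upper
    intro i
    have hc : ∀ j, (Pi.single i 1 : Fin k → ℕ) j ≤ 2 * B := by
      intro j; by_cases hj : j = i
      · subst hj; simp; omega
      · rw [Pi.single_eq_of_ne hj]; omega
    have h := hU (Pi.single i 1) hc
    have hbin : ∀ ω, sscBinom X (Pi.single i 1) ω = (X i ω : ℝ) := by
      intro ω; unfold sscBinom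
      rw [Finset.prod_eq_single i (fun j _ hj => by rw [Pi.single_eq_of_ne hj, Nat.choose_zero_right, Nat.cast_one])
        (fun h => absurd (Finset.mem_univ i) h), Pi.single_eq_same, Nat.choose_one_right]
    have hprod : ∏ j, lam j ^ (Pi.single i 1 : Fin k → ℕ) j / (((Pi.single i 1 : Fin k → ℕ) j)! : ℝ) = lam i := by
      rw [Finset.prod_eq_single i (fun j _ hj => by rw [Pi.single_eq_of_ne hj]; simp)
        (fun h => absurd (Finset.mem_univ i) h), Pi.single_eq_same]; simp
    simp_rw [hbin] at h; rw [hprod] at h; exact h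
  · intro i
    have hc : ∀ j, (Pi.single i 1 : Fin k → ℕ) j ≤ 2 * B := by
      intro j; by_cases hj : j = i
      · subst hj; simp; omega
      · rw [Pi.single_eq_of_ne hj]; omega
    have h := hL (Pi.single i 1) hc
    have hbin : ∀ ω, sscBinom X (Pi.single i 1) ω = (X i ω : ℝ) := by
      intro ω; unfold sscBinom
      rw [Finset.prod_eq_single i (fun j _ hj => by rw [Pi.single_eq_of_ne hj, Nat.choose_zero_right, Nat.cast_one])
        (fun h => absurd (Finset.mem_univ i) h), Pi.single_eq_same, Nat.choose_one_right]
    have hprod : ∏ j, lam j ^ (Pi.single i 1 : Fin k → ℕ) j / (((Pi.single i 1 : Fin k → ℕ) j)! : ℝ) = lam i := by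
      rw [Finset.prod_eq_single i (fun j _ hj => by rw [Pi.single_eq_of_ne hj]; simp)
        (fun h => absurd (Finset.mem_univ i) h), Pi.single_eq_same]; simp
    simp_rw [hbin] at h; rw [hprod] at h; exact h
  · intro i
    have hc : ∀ j, (Pi.single i 2 : Fin k → ℕ) j ≤ 2 * B := by
      intro j; by_cases hj : j = i
      · subst hj; simp; omega
      · rw [Pi.single_eq_of_ne hj]; omega
    have h := hU (Pi.single i 2) hc
    have hbin : ∀ ω, sscBinom X (Pi.single i 2) ω = ((X i ω).choose 2 : ℝ) := by
      intro ω; unfold sscBinom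
      rw [Finset.prod_eq_single i (fun j _ hj => by rw [Pi.single_eq_of_ne hj, Nat.choose_zero_right, Nat.cast_one])
        (fun h => absurd (Finset.mem_univ i) h), Pi.single_eq_same]
    have hprod : ∏ j, lam j ^ (Pi.single i 2 : Fin k → ℕ) j / (((Pi.single i 2 : Fin k → ℕ) j)! : ℝ) = lam i ^ 2 / 2 := by
      rw [Finset.prod_eq_single i (fun j _ hj => by rw [Pi.single_eq_of_ne hj]; simp)
        (fun h => absurd (Finset.mem_univ i) h), Pi.single_eq_same]; simp
    simp_rw [hbin] at h; rw [hprod] at h; exact h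
  · intro i j hij
    have hc : ∀ l, (Pi.single i 1 + Pi.single j 1 : Fin k → ℕ) l ≤ 2 * B := by
      intro l
      simp only [Pi.add_apply]
      by_cases hl : l = i
      · subst hl; rw [Pi.single_eq_same, Pi.single_eq_of_ne hij]; omega
      · rw [Pi.single_eq_of_ne hl]
        by_cases hl' : l = j
        · subst hl'; rw [Pi.single_eq_same]; omega
        · rw [Pi.single_eq_of_ne hl']; omega
    have h := hU (Pi.single i 1 + Pi.single j 1) hc
    have hbin : ∀ ω, sscBinom X (Pi.single i 1 + Pi.single j 1) ω = (X i ω : ℝ) * (X j ω : ℝ) := by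
      intro ω; unfold sscBinom
      rw [← Finset.mul_prod_erase _ _ (Finset.mem_univ i), ← Finset.mul_prod_erase _ _ (Finset.mem_erase.2 ⟨Ne.symm hij, Finset.mem_univ j⟩)]
      rw [Finset.prod_eq_one (fun l hl => by
        rw [Finset.mem_erase, Finset.mem_erase] at hl
        simp only [Pi.add_apply, Pi.single_eq_of_ne hl.1, Pi.single_eq_of_ne hl.2.1, add_zero, Nat.choose_zero_right, Nat.cast_one])]
      simp only [Pi.add_apply, Pi.single_eq_same, Pi.single_eq_of_ne hij, Pi.single_eq_of_ne (Ne.symm hij), add_zero, zero_add,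
        Nat.choose_one_right, mul_one]
    have hprod : ∏ l, lam l ^ (Pi.single i 1 + Pi.single j 1 : Fin k → ℕ) l / (((Pi.single i 1 + Pi.single j 1 : Fin k → ℕ) l)! : ℝ) =
        lam i * lam j := by
      rw [← Finset.mul_prod_erase _ _ (Finset.mem_univ i), ← Finset.mul_prod_erase _ _ (Finset.mem_erase.2 ⟨Ne.symm hij, Finset.mem_univ j⟩)]
      rw [Finset.prod_eq_one (fun l hl => by
        rw [Finset.mem_erase, Finset.mem_erase] at hl
        simp only [Pi.add_apply, Pi.single_eq_of_ne hl.1, Pi.single_eq_of_ne hl.2.1, add_zero]; simp)]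
      simp only [Pi.add_apply, Pi.single_eq_same, Pi.single_eq_of_ne hij, Pi.single_eq_of_ne (Ne.symm hij), add_zero, zero_add]
      simp
    simp_rw [hbin] at h; rw [hprod] at h; exact h
  -- assemble
  have h3' : ((univ.filter fun ω => ∑ i, ℓ i * X i ω ≤ ∑ i, ℓ i * lam i - M).card : ℝ) ≤
      Fintype.card Ω * (((1 + ε₁) * ∑ i, lam i * ℓ i ^ 2 + 3 * ε₁ * (∑ i, lam i * ℓ i) ^ 2) / M ^ 2) := by
    rw [mul_div_assoc', le_div_iff₀ (pow_pos hM 2)]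
    exact h3
  have h1' : ((univ.filter fun ω => Y ω ≤ t * avg ∧ u ≤ W ω).card : ℝ) ≤
      Fintype.card Ω * (((1 + ε₁) * τ - (1 - ε₁) ^ 2 * sscP lam δ B ^ 2 / ((1 + ε₁) * sscA lam δ B)) /
        (u * ((1 - ε₁) * sscP lam δ B / ((1 + ε₁) * sscA lam δ B)) - t) ^ 2) :=
    le_trans h1 (le_of_eq (mul_comm _ _))
  calc ((univ.filter fun ω => Y ω ≤ t * avg).card : ℝ)
      ≤ _ := hcardR
    _ ≤ Fintype.card Ω * (((1 + ε₁) * τ - (1 - ε₁) ^ 2 * sscP lam δ B ^ 2 / ((1 + ε₁) * sscA lam δ B)) /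
          (u * ((1 - ε₁) * sscP lam δ B / ((1 + ε₁) * sscA lam δ B)) - t) ^ 2) +
        (Fintype.card Ω * ((1 + ε₁) * ∑ i, lam i ^ (B + 1) / ((B + 1)! : ℝ)) +
          Fintype.card Ω * (((1 + ε₁) * ∑ i, lam i * ℓ i ^ 2 + 3 * ε₁ * (∑ i, lam i * ℓ i) ^ 2) / M ^ 2)) :=
        add_le_add h1' (add_le_add h2 h3')
    _ = _ := by simp only [hℓ, hu]; ring

end AbstractSSC2

end Literature.Computability.Complexity
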